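import Mathlib
import HarnessLib
import Summits.HubbardSuperconductivity.HubbardSuperconductivity.Theorems.KLProgrammeKLRegimeTwoVolumeFrameResponse
import Summits.HubbardSuperconductivity.HubbardSuperconductivity.Theorems.KLProgrammeKLRegimeTwoVolumeSubstitutionLipschitz
import Literature.MathematicalPhysics.QuantumLattice.GrassmannZoneLipschitzDB

/-!
# Route `KLProgramme` — crux K3, VL child `KLRegimeVolumeLimitV17F2` (stmt-HubbardSuperconductivity-20440), blueprint v5 «M3f»: THE FINE-SIDE FRAME COMPOSITE OF
# ONE SCALE — brackets (i) covariance response + (ii) re-analysis difference, as ONE pinned kernel-difference bound (seat hubbard-kl-k3c4-p1 g12; `--supports` 20440)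

Under the own-frame organisation the fine volume `L″` runs its TRUE step `O′ = effAction (C+E) (map T″ X)` (covariance and re-analysis at its own top
frame `K″`) while the two-volume step (`…SrcSectorScaleSuccMin/Wt`) compares `Oc′ = effAction C (map T X)` (the frame-`K` objects sampled on `L″`) with the
glued coarse volume.  k3c5-p3's splice `…TwoVolumeGluedTruncation.srcLabel_sum_filter_norm_srcTrunc_keyedGlued_le_of_response_of_le` (p586032) turns
`Σ_{X p = w}‖kernel O′ X − kernel Oc′ X‖ ≤ r` + the two-volume bound `≤ B` into the next scale's deep input `r + B`.  This file supplies `r`, generically: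

* `isTreeWeight_one` — the constant weight `1` is a tree weight (the plain Lipschitz bracket);
* `sum_filter_norm_kernel_add_le` — pinned profiles are subadditive;
* **`sum_norm_kernel_frameComposite_le`** — for `W := map T X`, `B := map T″ X − map T X`:
  `Σ_{Y p = w} ‖kernel (effAction (C+E) (map T″ X)) (n+1) Y − kernel (effAction C (map T X)) (n+1) Y‖ ≤ RESP(n) + LIP(n)`,
  `RESP` = the covariance-response bracket `…TwoVolumeFrameResponse.sum_norm_kernel_effAction_add_sub_le_response_of_gramBounded` (k3c5-p3, p545036) at the input
  `W + B` (entry sup `sE`, rows/cols `cR, cC` of `E` — k3c4-p2's M2 data), `LIP` = the interaction-Lipschitz bracket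
  `GrassmannZoneLipschitzDB.const_mul_sum_norm_kernel_effAction_add_sub_le_of_gramBounded` at `Z = univ`, weight `1`, with the plain profile of `B`
  `NB(m′) = 2m′·a^{2m′−1}·δ·NX(2m′)` (`…TwoVolumeSubstitutionLipschitz.sum_pinned_norm_kernel_map_sub_map_le`, p572182; `δ` = rows/cols of `T″ − T`, k3c4-p2 p587829).

Generic (any finite linearly ordered label type); proofs only; no definition.  References: BGM 2006 §3 (3.2)–(3.8); Salmhofer 1999 (2.102)–(2.106).
-/

noncomputable section

namespace Summit.HubbardSuperconductivity.HubbardSuperconductivity.Theorems.TwoVolumeDefect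

set_option linter.dupNamespace false -- summit = problem name (single-conjunct summit), D-0017

open Finset Literature.MathematicalPhysics.QuantumLattice GrassmannAlgebra Literature.Probability.LatticeModels
  Literature.Probability.LatticeModels.BattleFederbush
open scoped Nat InnerProductSpace

variable {𝕜 : Type*} [RCLike 𝕜]

/-- **The constant weight `1` is a tree weight.** [folklore] -/
theorem isTreeWeight_one {Λ : Type*} [DecidableEq Λ] : IsTreeWeight (fun _ : Finset Λ => (1 : ℝ)) where
  one_le _ := le_rfl
  mono _ _ _ := le_rfl
  union_le _ _ _ := by rw [mul_one]

/-- **Pinned profiles are subadditive**: `Σ_{Y j = x} ‖kernel (A + B) m Y‖ ≤ Σ ‖kernel A m Y‖ + Σ ‖kernel B m Y‖`. [folklore] -/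
theorem sum_filter_norm_kernel_add_le {Γ : Type*} [Fintype Γ] [DecidableEq Γ] (A B : GrassmannAlgebra 𝕜 Γ) (m : ℕ) (s : Finset (Fin m → Γ)) :
    ∑ Y ∈ s, ‖kernel 𝕜 (A + B) m Y‖ ≤ ∑ Y ∈ s, ‖kernel 𝕜 A m Y‖ + ∑ Y ∈ s, ‖kernel 𝕜 B m Y‖ := by
  rw [← sum_add_distrib]
  exact sum_le_sum fun Y _ => by rw [kernel_add]; exact norm_add_le _ _

/-- **THE FINE-SIDE FRAME COMPOSITE OF ONE SCALE** (see the module docstring): the true fine output against the common-frame comparison output, at any pin,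
from the covariance path's Gram property, rows/columns of `C`, the defect data `sE, cR, cC` of `E`, the substitution masses `a` and defect `δ`, the plain
profiles `NX` of the previous action and `NW` of its frame-`K` re-analysis, one field radius and two smallness conditions.
[folklore; BGM 2006 §3; Salmhofer 1999 (2.102)–(2.106)] -/
theorem sum_norm_kernel_frameComposite_le {Γ' : Type} [LinearOrder Γ'] [Fintype Γ'] {Γ₁' : Type*} [Fintype Γ₁'] [DecidableEq Γ₁']
    (C E : Matrix Γ' Γ' 𝕜) (T T'' : Matrix Γ' Γ₁' 𝕜) (X : GrassmannAlgebra 𝕜 Γ₁') (hXe : X ∈ evenOdd 𝕜 0) (hX0 : constPart 𝕜 X = 0)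
    -- covariance data: Gram property along the path, rows/columns of `C`, entry sup / rows / columns of the defect `E`
    {κ : ℝ} (hκ : 0 < κ) (hGB : ∀ t ∈ Set.Icc (0 : ℝ) 1, IsGramBoundedR (C + t • E) κ)
    {αC : ℝ} (hαC : 0 < αC) (hrow : ∀ x, ∑ y, ‖C x y‖ ≤ αC) (hcol : ∀ y, ∑ x, ‖C x y‖ ≤ αC)
    {sE cR cC : ℝ} (hsE : ∀ x y, ‖E x y‖ ≤ sE) (hcR : 0 ≤ cR) (hcC : 0 ≤ cC) (hR : ∀ x, ∑ y, ‖E x y‖ ≤ cR) (hCc : ∀ y, ∑ x, ‖E x y‖ ≤ cC)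
    -- substitution data: a common entrywise majorant with row/column masses `a`, the defect rows/columns `δ`
    (Tm : Γ' → Γ₁' → ℝ) {a δ : ℝ} (ha : 0 ≤ a) (hδ : 0 ≤ δ) (hT : ∀ x y, ‖T x y‖ ≤ Tm x y) (hT'' : ∀ x y, ‖T'' x y‖ ≤ Tm x y)
    (hTcol : ∀ y, ∑ x, Tm x y ≤ a) (hTrow : ∀ x, ∑ y, Tm x y ≤ a)
    (hδcol : ∀ y, ∑ x, ‖T'' x y - T x y‖ ≤ δ) (hδrow : ∀ x, ∑ y, ‖T'' x y - T x y‖ ≤ δ)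
    -- plain profiles: of the previous action (raw degree) and of its frame-`K` re-analysis (even degrees); the derived profile of `B`
    (NX : ℕ → ℝ) (hNX0 : ∀ k, 0 ≤ NX k)
    (hNX : ∀ (k : ℕ) (p : Fin k) (y : Γ₁'), ∑ Y ∈ univ.filter (fun Y : Fin k → Γ₁' => Y p = y), ‖kernel 𝕜 X k Y‖ ≤ NX k)
    (NW : ℕ → ℝ) (hNW0 : ∀ m', 0 ≤ NW m')
    (hNW : ∀ m' (j : Fin (2 * m')) (x : Γ'), ∑ Y ∈ univ.filter (fun Y : Fin (2 * m') → Γ' => Y j = x),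
      ‖kernel 𝕜 (ExteriorAlgebra.map (Matrix.toLin' T) X) (2 * m') Y‖ ≤ NW m')
    (NB : ℕ → ℝ) (hNBdef : ∀ m', NB m' = (2 * m' : ℕ) * a ^ (2 * m' - 1) * δ * NX (2 * m'))
    -- one field radius, two smallness conditions
    {ρ : ℝ} (hρ : 0 < ρ) (hθ₁ : Real.exp 1 * (αC + (cR + cC)) * normV Γ' κ ρ (fun m' => NW m' + NB m') / κ ^ 2 < 1)
    (hθ₂ : Real.exp 1 * αC * (normV Γ' κ ρ NW + normV Γ' κ ρ NB) / κ ^ 2 < 1)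
    (w : Γ') (n : ℕ) (p : Fin (n + 1)) :
    ∑ Y ∈ univ.filter (fun Y : Fin (n + 1) → Γ' => Y p = w),
        ‖kernel 𝕜 (effAction 𝕜 (C + E) (ExteriorAlgebra.map (Matrix.toLin' T'') X)) (n + 1) Y -
          kernel 𝕜 (effAction 𝕜 C (ExteriorAlgebra.map (Matrix.toLin' T) X)) (n + 1) Y‖ ≤
      ((((n + 1 + 1) * (n + 1 + 2) : ℕ) : ℝ) / 2 * sE *
          (ρ⁻¹ ^ (n + 3) * (Real.exp 1 * normV Γ' κ ρ (fun m' => NW m' + NB m')) /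
            (1 - Real.exp 1 * (αC + (cR + cC)) * normV Γ' κ ρ (fun m' => NW m' + NB m') / κ ^ 2)) +
        ‖(2 : 𝕜)⁻¹‖ * ∑ a' ∈ range (n + 2), ∑ b' ∈ range (n + 2),
          (if a' + b' = n + 1 then (((a' + 1) * (b' + 1) : ℕ) : ℝ) *
            (cR * (ρ⁻¹ ^ (a' + 1) * (Real.exp 1 * normV Γ' κ ρ (fun m' => NW m' + NB m')) /
                  (1 - Real.exp 1 * (αC + (cR + cC)) * normV Γ' κ ρ (fun m' => NW m' + NB m') / κ ^ 2)) *
                (ρ⁻¹ ^ (b' + 1) * (Real.exp 1 * normV Γ' κ ρ (fun m' => NW m' + NB m')) /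
                  (1 - Real.exp 1 * (αC + (cR + cC)) * normV Γ' κ ρ (fun m' => NW m' + NB m') / κ ^ 2)) +
              cC * (ρ⁻¹ ^ (a' + 1) * (Real.exp 1 * normV Γ' κ ρ (fun m' => NW m' + NB m')) /
                  (1 - Real.exp 1 * (αC + (cR + cC)) * normV Γ' κ ρ (fun m' => NW m' + NB m') / κ ^ 2)) *
                (ρ⁻¹ ^ (b' + 1) * (Real.exp 1 * normV Γ' κ ρ (fun m' => NW m' + NB m')) /
                  (1 - Real.exp 1 * (αC + (cR + cC)) * normV Γ' κ ρ (fun m' => NW m' + NB m') / κ ^ 2))) else 0)) +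
      ρ⁻¹ ^ (n + 1) * (Real.exp 1 * normV Γ' κ ρ NB) / (1 - Real.exp 1 * αC * (normV Γ' κ ρ NW + normV Γ' κ ρ NB) / κ ^ 2) ^ 2 := by
  classical
  -- the three actions: comparison input `W`, re-analysis defect `B`, true input `W + B`
  set W : GrassmannAlgebra 𝕜 Γ' := ExteriorAlgebra.map (Matrix.toLin' T) X with hWdef
  set B : GrassmannAlgebra 𝕜 Γ' := ExteriorAlgebra.map (Matrix.toLin' T'') X - ExteriorAlgebra.map (Matrix.toLin' T) X with hBdef
  have hW'' : ExteriorAlgebra.map (Matrix.toLin' T'') X = W + B := by rw [hWdef, hBdef]; abel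
  have hWe : W ∈ evenPart 𝕜 Γ' := (mem_evenPart_iff).2 (map_mem_evenOdd_zero 𝕜 (Matrix.toLin' T) hXe)
  have hW''e0 : ExteriorAlgebra.map (Matrix.toLin' T'') X ∈ evenOdd 𝕜 0 := map_mem_evenOdd_zero 𝕜 (Matrix.toLin' T'') hXe
  have hBe : B ∈ evenPart 𝕜 Γ' := (mem_evenPart_iff).2 (sub_mem hW''e0 (map_mem_evenOdd_zero 𝕜 (Matrix.toLin' T) hXe))
  have hWBe : W + B ∈ evenPart 𝕜 Γ' := add_mem hWe hBe
  have hW0 : constPart 𝕜 W = 0 := by rw [hWdef, constPart_map, hX0]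
  have hB0 : constPart 𝕜 B = 0 := by rw [hBdef, map_sub, constPart_map, constPart_map, hX0, sub_zero]
  have hWB0 : constPart 𝕜 (W + B) = 0 := by rw [map_add, hW0, hB0, add_zero]
  -- the plain profile of `B` (p572182), of `W + B`
  have hNB0 : ∀ m', 0 ≤ NB m' := fun m' => by rw [hNBdef]; exact mul_nonneg (mul_nonneg (mul_nonneg (Nat.cast_nonneg _) (pow_nonneg ha _)) hδ) (hNX0 _)
  have hNB : ∀ m' (j : Fin (2 * m')) (x : Γ'), ∑ Y ∈ univ.filter (fun Y : Fin (2 * m') → Γ' => Y j = x), ‖kernel 𝕜 B (2 * m') Y‖ ≤ NB m' := by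
    intro m'
    rcases Nat.eq_zero_or_pos m' with h0 | hpos
    · subst h0; intro j; exact absurd j.2 (by omega)
    · obtain ⟨n', hn'⟩ : ∃ n', 2 * m' = n' + 1 := ⟨2 * m' - 1, by omega⟩
      have hb : ((n' : ℝ) + 1) * a ^ n' * δ * NX (n' + 1) = NB m' := by
        rw [hNBdef, hn', Nat.add_sub_cancel]; push_cast; ring
      rw [hn']
      intro j x
      refine le_trans ?_ hb.le
      refine le_trans (le_of_eq (sum_congr rfl fun Y _ => by rw [hBdef, kernel_sub'])) ?_
      exact sum_pinned_norm_kernel_map_sub_map_le (𝕜 := 𝕜) T'' T Tm X j x ha hδ (hNX0 (n' + 1)) hT'' hT hTcol (hTrow x) hδcol (hδrow x)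
        (fun y => hNX (n' + 1) j y)
  have hNWB : ∀ m' (j : Fin (2 * m')) (x : Γ'), ∑ Y ∈ univ.filter (fun Y : Fin (2 * m') → Γ' => Y j = x), ‖kernel 𝕜 (W + B) (2 * m') Y‖ ≤ NW m' + NB m' :=
    fun m' j x => (sum_filter_norm_kernel_add_le W B _ _).trans (add_le_add (hNW m' j x) (hNB m' j x))
  -- bracket (i): covariance response at the true input
  have h1 := sum_norm_kernel_effAction_add_sub_le_response_of_gramBounded C E (W + B) hWBe hWB0 (fun m' => NW m' + NB m')
    (fun m' => add_nonneg (hNW0 m') (hNB0 m')) hNWB hκ hGB hαC hrow hcol hsE hcR hcC hR hCc hρ hθ₁ w n p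
  -- bracket (ii): interaction Lipschitz in the re-analysis defect (zone = everything, weight `1`)
  have hGB0 : IsGramBoundedR C κ := by simpa using hGB 0 ⟨le_rfl, zero_le_one⟩
  have h2 := const_mul_sum_norm_kernel_effAction_add_sub_le_of_gramBounded (𝕜 := 𝕜) (wt := fun _ : Finset Γ' => (1 : ℝ)) C isTreeWeight_one hκ hGB0 W B hWe hBe
    hW0 hB0 NW NB hNW0 hNB0 (fun m' j x => by simpa using hNW m' j x) (fun m' j x => by simpa using hNB m' j x) hαC
    (fun x => by simpa using hrow x) (fun y => by simpa using hcol y) hρ hθ₂ Set.univ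
    (fun m' Y hY => by
      rcases Nat.eq_zero_or_pos m' with h0 | hpos
      · subst h0; exact absurd (by rw [kernel_zero, hB0]) hY
      · exact ⟨⟨0, by omega⟩, Set.mem_univ _⟩)
    w zero_le_one (fun S _ _ => le_rfl) (Nat.succ_pos n) p
  rw [one_mul] at h2
  -- assemble by the triangle inequality
  rw [hW'']
  calc ∑ Y ∈ univ.filter (fun Y : Fin (n + 1) → Γ' => Y p = w),
          ‖kernel 𝕜 (effAction 𝕜 (C + E) (W + B)) (n + 1) Y - kernel 𝕜 (effAction 𝕜 C W) (n + 1) Y‖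
      ≤ ∑ Y ∈ univ.filter (fun Y : Fin (n + 1) → Γ' => Y p = w),
          (‖kernel 𝕜 (effAction 𝕜 (C + E) (W + B)) (n + 1) Y - kernel 𝕜 (effAction 𝕜 C (W + B)) (n + 1) Y‖ +
            ‖kernel 𝕜 (effAction 𝕜 C (W + B)) (n + 1) Y - kernel 𝕜 (effAction 𝕜 C W) (n + 1) Y‖) :=
        sum_le_sum fun Y _ => norm_sub_le_norm_sub_add_norm_sub _ _ _
    _ ≤ _ := by rw [sum_add_distrib]; exact add_le_add h1 h2

end Summit.HubbardSuperconductivity.HubbardSuperconductivity.Theorems.TwoVolumeDefect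

end
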